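/- Copyright: the b2b-balaban cell (near-miss cell 7), T⁴-continuum fan-out, lineage t4-ne7b-p1 (node U5c COUNT
member).  Released under the licence of the surrounding project. -/
import Summits.QuantumFields.BalabanUV.T4Continuum.Support.HistoryGenealogyDissolve

/-!
# DISSOLVING THE FRESH CLUSTERS (junction M4, pass V, part 1b — the bookkeeping: `WF` and `NoFreshClusters`): the
dissolved bookkeeping of part 1a is well-formed under the admissible splice order and the label condition, and it has
NO FRESH CLUSTERS by construction (owner module of row NE7b, lineage `t4-ne7b-p1` gen 42; ruling R-OWNER-42-1 «pass V
supersedes pass T» = R-OWNER-22-7 (α) at the junction; re-open object (α), `SCOPE-alpha.md` v2.3 §5 row M4, located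
open point G-M4-1 — PRE-POSITIONING ONLY)

Summits-side support leaf of the T⁴-continuum cell (rung (B)+1 on a FINITE torus only; NOT infinite volume, NOT the
mass gap, NOT the Clay statement; NOT a proof of the spine estimate NE7b, which is the cell's OWN estimate, NOT PRINTED
and NOT PROVED).  [folklore] finite list ∕ finset combinatorics over part 1a (`Fresh`, `pseudo`, `partV`, `splice`,
`dissolve` and their bookkeeping lemmas), row S13's `ComponentHistory.WF` and brick 2c's displayed condition
`HistoryGenealogyPedigree.NoFreshClusters`; PROCESS-AGNOSTIC; nothing printed is asserted, no `def … : Prop` fact of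
Bałaban's (`SpliceOK`∕`LabelOK` are displayed hypothesis SHAPES on OUR bookkeeping), no cite-tagged hypothesis, zero
`sorry`.  B16 = [Balaban1989LargeFieldII] pp. 385–386 under audit; locators only.

WHAT.  §3 **`SpliceOK`** (the splice order enumerates exactly the fresh part's new regions, a permutation of `news`)
and **`LabelOK`** (a new region of a fresh cluster is not the label of a component of its level; in the instance labels
are `(0, domain)` and distinct new regions of one level are disjoint), `real_or_pseudo` (the exclusive dichotomy of a
dissolved component), `mem_partV_cases`; §4 **`wf_dissolve : H.WF → H.SpliceOK spl → H.LabelOK → (H.dissolve spl).WF`**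
(parts duplicate-free after the splice: replacements of distinct parts are disjoint because news of distinct components
are; parts of distinct components disjoint likewise; news untouched); §5–§6 **`noFreshClusters_dissolve`**: a
dissolved component of level `0` has at most one constituent (a real one is non-fresh with no old part; a pseudo one is
a lone birth), and a dissolved component of a successor level with `≥ 2` constituents has an old part (a real non-fresh
one with no old part has `≤ 1` constituent and the splice changes nothing; otherwise its first old part contributes a
nonempty replacement).

HONEST.  Proves nothing of Bałaban's; a re-indexing of OUR bookkeeping; by-name class of every `WALL-NE7b-P1.md` §2
binder UNCHANGED; NE7b NOT proved; spine 0∕9.  HONEST DEPENDENCY (cell): continuum YM on T⁴ ⇐ BetaPertH ∧ nine spine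
estimates (0/9 proved); BetaPertH ⇐ (D1) ∧ (D4) ∧ CAP+tail; G-an2-4 gates asym, D1 and NE2/3/4.  This file changes none
of it. -/

open Finset
open Literature.MathematicalPhysics.QuantumFieldTheory.Balaban1983to89
open Summit.QuantumFields.BalabanUV.T4Continuum.HistoryGenealogyExtraction
open Summit.QuantumFields.BalabanUV.T4Continuum.HistoryGenealogyRealise (Lab)

namespace Summit.QuantumFields.BalabanUV.T4Continuum.HistoryGenealogyExtraction

namespace ComponentHistory

noncomputable section

open Classical

variable {γ : Type*} [DecidableEq γ] (H : ComponentHistory γ) (spl : ℕ → γ → γ → List γ)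

/-! ## §3 The side conditions on the splice order and on the labels -/

/-- **THE SPLICE ORDER IS ADMISSIBLE**: for every fresh part continued into a component, the chosen list enumerates
exactly the fresh part's new regions without repetition (a permutation of `news`). [folklore] -/
def SpliceOK : Prop :=
  ∀ j c p, c ∈ H.comp (j + 1) → p ∈ H.parts (j + 1) c → H.Fresh j p → (spl j c p).Perm (H.news j p)

/-- **THE LABEL CONDITION**: a new region of a fresh cluster is not the label of a component of its level (in the
instance: labels are `(0, domain)` and distinct new regions of one level are disjoint). [folklore] -/
def LabelOK : Prop := ∀ j c, H.Fresh j c → ∀ n ∈ H.news j c, n ∉ H.comp j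

variable {H spl}

/-- a pseudo-component is not a component of its level (under the label condition) [folklore] -/
theorem not_mem_comp_of_mem_pseudo (hL : H.LabelOK) {j : ℕ} {n : γ} (hn : n ∈ H.pseudo j) : n ∉ H.comp j := by
  obtain ⟨c, hf, hn⟩ := H.mem_pseudo_iff.1 hn
  exact hL j c hf n hn

/-- a component of its level is not a pseudo-component (under the label condition) [folklore] -/
theorem not_mem_pseudo_of_mem_comp (hL : H.LabelOK) {j : ℕ} {c : γ} (hc : c ∈ H.comp j) : c ∉ H.pseudo j :=
  fun hn => not_mem_comp_of_mem_pseudo hL hn hc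

/-- the dichotomy of a dissolved component under the label condition: real non-fresh, or pseudo — exclusively [folklore] -/
theorem real_or_pseudo (hL : H.LabelOK) {j : ℕ} {x : γ} (hx : x ∈ (H.dissolve spl).comp j) :
    (x ∈ H.comp j ∧ ¬ H.Fresh j x ∧ x ∉ H.pseudo j) ∨ (x ∈ H.pseudo j ∧ x ∉ H.comp j) := by
  rcases (H.mem_comp_dissolve_iff spl).1 hx with ⟨hc, hf⟩ | hp
  · exact Or.inl ⟨hc, hf, not_mem_pseudo_of_mem_comp hL hc⟩
  · exact Or.inr ⟨hp, not_mem_comp_of_mem_pseudo hL hp⟩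

/-- under `SpliceOK` the replacement of a fresh part is duplicate-free [folklore] -/
theorem nodup_spl (hW : H.WF) (hS : H.SpliceOK spl) {j : ℕ} {c p : γ} (hc : c ∈ H.comp (j + 1))
    (hp : p ∈ H.parts (j + 1) c) (hf : H.Fresh j p) : (spl j c p).Nodup :=
  (hS j c p hc hp hf).nodup_iff.2 (hW.news_nodup j p)

omit [DecidableEq γ] in
/-- under `SpliceOK` the replacement of a fresh part is nonempty [folklore] -/
theorem spl_ne_nil (hS : H.SpliceOK spl) {j : ℕ} {c p : γ} (hc : c ∈ H.comp (j + 1)) (hp : p ∈ H.parts (j + 1) c)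
    (hf : H.Fresh j p) : spl j c p ≠ [] := fun he => by
  have h := (hS j c p hc hp hf).length_eq
  rw [he, List.length_nil] at h
  exact hf.news_ne_nil (List.eq_nil_of_length_eq_zero h.symm)

omit [DecidableEq γ] in
/-- under `SpliceOK` the members of the replacement of a fresh part are its new regions [folklore] -/
theorem mem_spl_iff (hS : H.SpliceOK spl) {j : ℕ} {c p : γ} (hc : c ∈ H.comp (j + 1)) (hp : p ∈ H.parts (j + 1) c)
    (hf : H.Fresh j p) {q : γ} : q ∈ spl j c p ↔ q ∈ H.news j p :=
  (hS j c p hc hp hf).mem_iff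

omit [DecidableEq γ] in
/-- every replacement list inside a component is nonempty (under `SpliceOK`) [folklore] -/
theorem partV_ne_nil (hS : H.SpliceOK spl) {j : ℕ} {c : γ} (hc : c ∈ H.comp (j + 1)) {p : γ}
    (hp : p ∈ H.parts (j + 1) c) : H.partV spl j c p ≠ [] := by
  by_cases hf : H.Fresh j p
  · rw [H.partV_of_fresh spl c hf]; exact spl_ne_nil hS hc hp hf
  · rw [H.partV_of_not_fresh spl c hf]; exact List.cons_ne_nil _ _

/-- a member of a replacement list inside a component is a pseudo-component or a real non-fresh component of the part
level (under `WF`, `SpliceOK`) [folklore] -/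
theorem mem_partV_cases (hW : H.WF) (hS : H.SpliceOK spl) {j : ℕ} {c : γ} (hc : c ∈ H.comp (j + 1)) {p q : γ}
    (hp : p ∈ H.parts (j + 1) c) (hq : q ∈ H.partV spl j c p) :
    (H.Fresh j p ∧ q ∈ H.news j p ∧ q ∈ H.pseudo j) ∨ (¬ H.Fresh j p ∧ q = p ∧ q ∈ H.comp j) := by
  by_cases hf : H.Fresh j p
  · rw [H.partV_of_fresh spl c hf] at hq
    have hq' := (mem_spl_iff hS hc hp hf).1 hq
    exact Or.inl ⟨hf, hq', H.mem_pseudo_iff.2 ⟨p, hf, hq'⟩⟩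
  · rw [H.partV_of_not_fresh spl c hf, List.mem_singleton] at hq
    subst hq
    exact Or.inr ⟨hf, rfl, hW.parts_sub j c hc q hp⟩

/-! ## §4 `WF` of the dissolved bookkeeping -/

/-- the parts of a dissolved component: empty at level `0` and for pseudo-components and off the components
[folklore] -/
theorem parts_dissolve_zero_eq_nil (hW : H.WF) (x : γ) : (H.dissolve spl).parts 0 x = [] := by
  classical
  by_cases hp : x ∈ H.pseudo 0
  · exact H.parts_dissolve_pseudo spl hp
  · by_cases hx : x ∈ H.comp 0 ∧ ¬ H.Fresh 0 x
    · rw [H.parts_dissolve_zero spl hx.1 hx.2 hp]; exact hW.parts_zero x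
    · have : x ∉ (H.dissolve spl).comp 0 := fun h => by
        rcases (H.mem_comp_dissolve_iff spl).1 h with h | h
        · exact hx h
        · exact hp h
      rw [parts, H.constit_dissolve_of_not_mem spl this]; rfl

/-- **THE PARTS OF A REAL NON-FRESH COMPONENT ARE DUPLICATE-FREE** after the splice (under `WF`, `SpliceOK`,
`LabelOK`): replacements are duplicate-free, replacements of distinct parts are disjoint (news of distinct components
are disjoint; a real part is no pseudo-component). [folklore] -/
theorem nodup_parts_dissolve_succ (hW : H.WF) (hS : H.SpliceOK spl) (hL : H.LabelOK) {j : ℕ} {c : γ}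
    (hc : c ∈ H.comp (j + 1)) (hf : ¬ H.Fresh (j + 1) c) (hp : c ∉ H.pseudo (j + 1)) :
    ((H.dissolve spl).parts (j + 1) c).Nodup := by
  rw [H.parts_dissolve_succ spl hc hf hp, List.nodup_flatMap]
  refine ⟨fun p hp' => ?_, ?_⟩
  · by_cases hfp : H.Fresh j p
    · rw [H.partV_of_fresh spl c hfp]; exact nodup_spl hW hS hc hp' hfp
    · rw [H.partV_of_not_fresh spl c hfp]; exact List.nodup_singleton p
  · have hpw : (H.parts (j + 1) c).Pairwise (· ≠ ·) := hW.parts_nodup (j + 1) c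
    refine hpw.imp_of_mem fun {p p'} hpm hpm' hne => ?_
    show List.Disjoint (H.partV spl j c p) (H.partV spl j c p')
    rw [List.disjoint_left]
    intro q hq hq'
    rcases mem_partV_cases hW hS hc hpm hq with ⟨hfp, hqn, -⟩ | ⟨hfp, hqp, hqc⟩
    · rcases mem_partV_cases hW hS hc hpm' hq' with ⟨hfp', hqn', -⟩ | ⟨hfp', hqp', hqc'⟩
      · have hnd := hW.news_disj j p p' (hW.parts_sub j c hc p hpm) (hW.parts_sub j c hc p' hpm') hne
        rw [List.disjoint_toFinset_iff_disjoint, List.disjoint_left] at hnd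
        exact hnd hqn hqn'
      · exact hL j p hfp q hqn hqc'
    · rcases mem_partV_cases hW hS hc hpm' hq' with ⟨hfp', hqn', -⟩ | ⟨hfp', hqp', hqc'⟩
      · exact hL j p' hfp' q hqn' hqc
      · exact hne (hqp.symm.trans hqp')

/-- **`WF` OF THE DISSOLVED BOOKKEEPING** from `WF`, the admissible splice order and the label condition. [folklore] -/
theorem wf_dissolve (hW : H.WF) (hS : H.SpliceOK spl) (hL : H.LabelOK) : (H.dissolve spl).WF where
  parts_zero := fun x => parts_dissolve_zero_eq_nil hW x
  parts_nodup j x := by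
    classical
    by_cases hx : x ∈ (H.dissolve spl).comp j
    · rcases real_or_pseudo hL hx with ⟨hc, hf, hp⟩ | ⟨hp, -⟩
      · cases j with
        | zero => rw [parts_dissolve_zero_eq_nil hW x]; exact List.nodup_nil
        | succ j => exact nodup_parts_dissolve_succ hW hS hL hc hf hp
      · rw [H.parts_dissolve_pseudo spl hp]; exact List.nodup_nil
    · rw [parts, H.constit_dissolve_of_not_mem spl hx]; exact List.nodup_nil
  news_nodup j x := by
    classical
    by_cases hx : x ∈ (H.dissolve spl).comp j
    · rcases real_or_pseudo hL hx with ⟨hc, hf, hp⟩ | ⟨hp, -⟩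
      · rw [H.news_dissolve_real spl hc hf hp]; exact hW.news_nodup j x
      · rw [H.news_dissolve_pseudo spl hp]; exact List.nodup_singleton x
    · rw [news, H.constit_dissolve_of_not_mem spl hx]; exact List.nodup_nil
  parts_sub j x hx q hq := by
    rcases real_or_pseudo hL hx with ⟨hc, hf, hp⟩ | ⟨hp, -⟩
    · rcases (H.mem_parts_dissolve_succ_iff spl hc hf hp).1 hq with ⟨hq', hfq⟩ | ⟨p, hp', hfp, hq'⟩
      · exact H.mem_comp_dissolve_of_real spl (hW.parts_sub j x hc q hq') hfq
      · exact H.mem_comp_dissolve_of_pseudo spl (H.mem_pseudo_iff.2 ⟨p, hfp, (mem_spl_iff hS hc hp' hfp).1 hq'⟩)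
    · rw [H.parts_dissolve_pseudo spl hp] at hq; simp at hq
  news_sub j x hx n hn := by
    rcases real_or_pseudo hL hx with ⟨hc, hf, hp⟩ | ⟨hp, -⟩
    · rw [H.news_dissolve_real spl hc hf hp] at hn; exact hW.news_sub j x hc n hn
    · rw [H.news_dissolve_pseudo spl hp, List.mem_singleton] at hn
      subst hn
      obtain ⟨c, hfc, hn⟩ := H.mem_pseudo_iff.1 hp
      exact hW.news_sub j c hfc.mem n hn
  nonempty j x hx := by
    rcases real_or_pseudo hL hx with ⟨hc, hf, hp⟩ | ⟨hp, -⟩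
    · cases j with
      | zero => rw [H.constit_dissolve_zero spl hc hf hp]; exact hW.nonempty 0 x hc
      | succ j =>
          rw [H.constit_dissolve_succ spl hc hf hp]
          intro he
          obtain ⟨y, l, hyl⟩ := List.exists_cons_of_ne_nil (hW.nonempty (j + 1) x hc)
          rw [hyl] at he
          cases y with
          | inl p' =>
              rw [splice_cons_inl, List.append_eq_nil_iff, List.map_eq_nil_iff] at he
              exact partV_ne_nil hS hc ((mem_lefts_iff p' _).2 (by rw [hyl]; exact List.mem_cons_self)) he.1
          | inr n => rw [splice_cons_inr] at he; exact List.cons_ne_nil _ _ he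
    · rw [H.constit_dissolve_pseudo spl hp]; exact List.cons_ne_nil _ _
  parts_disj j x x' hx hx' hne := by
    rw [List.disjoint_toFinset_iff_disjoint, List.disjoint_left]
    intro q hq hq'
    rcases real_or_pseudo hL hx with ⟨hc, hf, hp⟩ | ⟨hp, -⟩
    · rcases real_or_pseudo hL hx' with ⟨hc', hf', hp'⟩ | ⟨hp', -⟩
      · have hdj := hW.parts_disj j x x' hc hc' hne
        rw [List.disjoint_toFinset_iff_disjoint, List.disjoint_left] at hdj
        rcases (H.mem_parts_dissolve_succ_iff spl hc hf hp).1 hq with ⟨hq1, hfq⟩ | ⟨p, hpm, hfp, hqs⟩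
        · rcases (H.mem_parts_dissolve_succ_iff spl hc' hf' hp').1 hq' with ⟨hq1', -⟩ | ⟨p', hpm', hfp', hqs'⟩
          · exact hdj hq1 hq1'
          · exact hL j p' hfp' q ((mem_spl_iff hS hc' hpm' hfp').1 hqs') (hW.parts_sub j x hc q hq1)
        · have hqn := (mem_spl_iff hS hc hpm hfp).1 hqs
          rcases (H.mem_parts_dissolve_succ_iff spl hc' hf' hp').1 hq' with ⟨hq1', -⟩ | ⟨p', hpm', hfp', hqs'⟩
          · exact hL j p hfp q hqn (hW.parts_sub j x' hc' q hq1')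
          · have hqn' := (mem_spl_iff hS hc' hpm' hfp').1 hqs'
            have hpp : p ≠ p' := fun h => hdj hpm (h ▸ hpm')
            have := hW.news_disj j p p' (hW.parts_sub j x hc p hpm) (hW.parts_sub j x' hc' p' hpm') hpp
            rw [List.disjoint_toFinset_iff_disjoint, List.disjoint_left] at this
            exact this hqn hqn'
      · rw [H.parts_dissolve_pseudo spl hp'] at hq'; simp at hq'
    · rw [H.parts_dissolve_pseudo spl hp] at hq; simp at hq
  news_disj j x x' hx hx' hne := by
    rw [List.disjoint_toFinset_iff_disjoint, List.disjoint_left]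
    intro n hn hn'
    rcases real_or_pseudo hL hx with ⟨hc, hf, hp⟩ | ⟨hp, hxc⟩
    · rw [H.news_dissolve_real spl hc hf hp] at hn
      rcases real_or_pseudo hL hx' with ⟨hc', hf', hp'⟩ | ⟨hp', -⟩
      · rw [H.news_dissolve_real spl hc' hf' hp'] at hn'
        have := hW.news_disj j x x' hc hc' hne
        rw [List.disjoint_toFinset_iff_disjoint, List.disjoint_left] at this
        exact this hn hn'
      · rw [H.news_dissolve_pseudo spl hp', List.mem_singleton] at hn'
        subst hn'
        obtain ⟨c₀, hf₀, hn₀⟩ := H.mem_pseudo_iff.1 hp'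
        have hne₀ : x ≠ c₀ := fun h => hf (h ▸ hf₀)
        have := hW.news_disj j x c₀ hc hf₀.mem hne₀
        rw [List.disjoint_toFinset_iff_disjoint, List.disjoint_left] at this
        exact this hn hn₀
    · rw [H.news_dissolve_pseudo spl hp, List.mem_singleton] at hn
      subst hn
      rcases real_or_pseudo hL hx' with ⟨hc', hf', hp'⟩ | ⟨hp', -⟩
      · rw [H.news_dissolve_real spl hc' hf' hp'] at hn'
        obtain ⟨c₀, hf₀, hn₀⟩ := H.mem_pseudo_iff.1 hp
        have hne₀ : c₀ ≠ x' := fun h => hf' (h ▸ hf₀)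
        have := hW.news_disj j c₀ x' hf₀.mem hc' hne₀
        rw [List.disjoint_toFinset_iff_disjoint, List.disjoint_left] at this
        exact this hn₀ hn'
      · rw [H.news_dissolve_pseudo spl hp', List.mem_singleton] at hn'
        exact hne hn'

/-! ## §5 No fresh clusters in the dissolved bookkeeping -/

/-- a dissolved component of level `0` has at most one constituent (under `WF`, `LabelOK`) [folklore] -/
theorem length_constit_dissolve_zero_le_one (hW : H.WF) (hL : H.LabelOK) {x : γ} (hx : x ∈ (H.dissolve spl).comp 0) :
    ((H.dissolve spl).constit 0 x).length ≤ 1 := by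
  rcases real_or_pseudo hL hx with ⟨hc, hf, hp⟩ | ⟨hp, -⟩
  · rw [H.constit_dissolve_zero spl hc hf hp]
    by_contra h
    exact hf ⟨hc, hW.parts_zero x, by omega⟩
  · rw [H.constit_dissolve_pseudo spl hp]; simp

/-- a dissolved component of a successor level with at least two constituents has an old part (under `WF`,
`SpliceOK`, `LabelOK`) [folklore] -/
theorem parts_dissolve_succ_ne_nil (hS : H.SpliceOK spl) (hL : H.LabelOK) {j : ℕ} {x : γ}
    (hx : x ∈ (H.dissolve spl).comp (j + 1)) (h2 : 2 ≤ ((H.dissolve spl).constit (j + 1) x).length) :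
    (H.dissolve spl).parts (j + 1) x ≠ [] := by
  rcases real_or_pseudo hL hx with ⟨hc, hf, hp⟩ | ⟨hp, -⟩
  · by_cases hpn : H.parts (j + 1) x = []
    · -- no old part and not fresh: at most one constituent, and the splice changes nothing
      rw [H.constit_dissolve_succ spl hc hf hp, splice_eq_self_of_lefts_eq_nil _ (show lefts _ = [] from hpn)] at h2
      exact absurd ⟨hc, hpn, h2⟩ hf
    · obtain ⟨p, ps, hps⟩ := List.exists_cons_of_ne_nil hpn
      have hpm : p ∈ H.parts (j + 1) x := by rw [hps]; exact List.mem_cons_self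
      obtain ⟨q, qs, hq⟩ := List.exists_cons_of_ne_nil (partV_ne_nil hS hc hpm)
      intro he
      have : q ∈ (H.dissolve spl).parts (j + 1) x := by
        rw [H.parts_dissolve_succ spl hc hf hp, List.mem_flatMap]
        exact ⟨p, hpm, by rw [hq]; exact List.mem_cons_self⟩
      rw [he] at this
      simp at this
  · rw [H.constit_dissolve_pseudo spl hp] at h2; simp at h2

end

end ComponentHistory

/-! ## §6 The displayed junction condition holds of the dissolved bookkeeping -/

section Lab

open Summit.QuantumFields.BalabanUV.T4Continuum.HistoryGenealogyPedigree

variable {d : ℕ} {H : ComponentHistory (Lab d)} {spl : ℕ → Lab d → Lab d → List (Lab d)}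

/-- **`NoFreshClusters` HOLDS OF THE DISSOLVED BOOKKEEPING** (under `WF`, the admissible splice order and the label
condition): the junction's displayed condition of located open point G-M4-1 is DISCHARGED for `H.dissolve spl`.
[folklore] -/
theorem noFreshClusters_dissolve (hW : H.WF) (hS : H.SpliceOK spl) (hL : H.LabelOK) :
    NoFreshClusters (H.dissolve spl) where
  zero _ hx := ComponentHistory.length_constit_dissolve_zero_le_one hW hL hx
  succ _ _ hx h2 := ComponentHistory.parts_dissolve_succ_ne_nil hS hL hx h2

end Lab

end Summit.QuantumFields.BalabanUV.T4Continuum.HistoryGenealogyExtraction
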